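import Literature.Geometry.Riemannian.AbreschGromollExcess
import Literature.Geometry.Riemannian.AbreschGromollProfile
import HarnessLib

/-!
# The Abresch–Gromoll excess estimate (Zhu 1997, Thm. 4.15)

U. Abresch, D. Gromoll, *On complete manifolds with nonnegative Ricci curvature*, J. Amer.
Math. Soc. 3 (1990), Prop. 2.3, in the form of S.-H. Zhu, *The comparison geometry of Ricci
curvature*, MSRI Publ. 30 (1997), Thm. 4.15 (held; PDF p. 286): on a complete Riemannian
`n`-manifold with `Ric ≥ 0`, for `p, q, x` with height `h(x) ≤ s(x)/2`
(`s = min(d(p,x), d(q,x))`, `h` the distance from `x` to a minimal segment from `p` to `q`),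
the excess satisfies `e(x) = d(p,x) + d(x,q) - d(p,q) ≤ 8 (hⁿ/s)^{1/(n-1)}`.

We PROVE it (`abreschGromoll_excess_estimate`, `n ≥ 3`, with `y₀` any point of zero excess and
`h = d(x, y₀)`, `0 < s ≤ min(d(p,x), d(q,x))` — the printed statement is the case of the foot
point, `exists_isMinOn_edist_curve`, `excess_expMap_smul_eq_zero`), following the printed proof:
Lemma 4.14 (`abreschGromoll_lemma`, `AbreschGromollExcess.lean`) with `a = 2`,
`b = 2(n-1)/(s-R)`, `R = h + η` and the profile of `AbreschGromollProfile.lean`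
(`excess_le_agProfile`), the limit `η → 0⁺`, and the arithmetic of the printed proof
(`ag_arith`: `2c + G(c) ≤ 8 (hⁿ/s)^{1/(n-1)}` for `c = (2hⁿ/s)^{1/(n-1)}`).
No definitions, no named facts (D-0026). Groundwork for `CheegerColding1997_sphereStability`
(Cheeger–Colding 1996, Prop. 6.2 / §6 use the excess estimate).

## References

* U. Abresch, D. Gromoll, J. Amer. Math. Soc. 3 (1990) 355–374, Prop. 2.3. [AbreschGromoll1990]
* S.-H. Zhu, in *Comparison Geometry*, MSRI Publ. 30 (1997) 221–262, Thm. 4.15.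
  [Zhu1997ComparisonRicci]
* J. Cheeger, T. H. Colding, Ann. of Math. 144 (1996) 189–237, Prop. 6.2. [CheegerColding1996]
-/

noncomputable section

open Bundle Set Function Filter
open scoped Manifold ContDiff Topology ENNReal NNReal Real

namespace Literature.Geometry.Riemannian

open Lorentzian Lorentzian.PseudoRiemannianMetric

/-! ### The arithmetic of the printed proof -/


/-- **The Abresch–Gromoll radius** `c = (2hᵐ/s)^{1/(m-1)}` satisfies `cᵐ⁻¹ = 2hᵐ/s` and
`0 < c ≤ h` when `0 < h ≤ s/2` (`m ≥ 2`). [cite: Zhu1997ComparisonRicci, Thm. 4.15] -/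
theorem agRadius_pos_le (m : ℕ) (hm : 2 ≤ m) {h s : ℝ} (hh : 0 < h) (hs : 0 < s) (hhs : h ≤ s / 2) :
    0 < (2 * h ^ m / s) ^ (1 / ((m : ℝ) - 1)) ∧
      ((2 * h ^ m / s) ^ (1 / ((m : ℝ) - 1))) ^ (m - 1) = 2 * h ^ m / s ∧
        (2 * h ^ m / s) ^ (1 / ((m : ℝ) - 1)) ≤ h := by
  have hm2 : (2 : ℝ) ≤ m := by exact_mod_cast hm
  have hm1 : 0 < (m : ℝ) - 1 := by linarith
  set A : ℝ := 2 * h ^ m / s with hA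
  have hA0 : 0 < A := by positivity
  set c : ℝ := A ^ (1 / ((m : ℝ) - 1)) with hc_def
  have hc0 : 0 < c := Real.rpow_pos_of_pos hA0 _
  have hcm1 : c ^ (m - 1) = A := by
    rw [hc_def, ← Real.rpow_natCast, ← Real.rpow_mul hA0.le, Nat.cast_sub (by omega : 1 ≤ m),
      Nat.cast_one, one_div_mul_cancel hm1.ne', Real.rpow_one]
  refine ⟨hc0, hcm1, ?_⟩
  have h1 : c ^ (m - 1) ≤ h ^ (m - 1) := by
    rw [hcm1, hA]
    have h2 : h ^ m = h ^ (m - 1) * h := by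
      rw [← pow_succ, Nat.sub_add_cancel (by omega : 1 ≤ m)]
    rw [h2, div_le_iff₀ hs]
    have h3 : 0 < h ^ (m - 1) := pow_pos hh _
    nlinarith
  exact (pow_le_pow_iff_left₀ hc0.le hh.le (by omega : m - 1 ≠ 0)).1 h1

/-- **The arithmetic of Zhu 1997, Thm. 4.15**: with `c = (2hᵐ/s)^{1/(m-1)}`, `0 < h ≤ s/2`,
`0 ≤ b ≤ 4(m-1)/s`, `m ≥ 3`:
`2c + (b/2m)(c² + (2/(m-2)) hᵐ c^{2-m} - (m/(m-2)) h²) ≤ 8 (hᵐ/s)^{1/(m-1)}`.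
[cite: Zhu1997ComparisonRicci, Thm. 4.15] -/
theorem ag_arith (m : ℕ) (hm : 3 ≤ m) {h s b : ℝ} (hh : 0 < h) (hs : 0 < s) (hhs : h ≤ s / 2)
    (hb0 : 0 ≤ b) (hb : b ≤ 4 * ((m : ℝ) - 1) / s) :
    2 * (2 * h ^ m / s) ^ (1 / ((m : ℝ) - 1)) +
      b / (2 * m) * (((2 * h ^ m / s) ^ (1 / ((m : ℝ) - 1))) ^ 2 +
        2 / ((m : ℝ) - 2) * h ^ m * ((2 * h ^ m / s) ^ (1 / ((m : ℝ) - 1))) ^ (2 - (m : ℤ)) -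
          m / ((m : ℝ) - 2) * h ^ 2) ≤
      8 * (h ^ m / s) ^ (1 / ((m : ℝ) - 1)) := by
  have hm3 : (3 : ℝ) ≤ m := by exact_mod_cast hm
  have hm1 : 0 < (m : ℝ) - 1 := by linarith
  have hm2 : 0 < (m : ℝ) - 2 := by linarith
  have hmpos : (0 : ℝ) < m := by linarith
  obtain ⟨hc0, hcm1, hch⟩ := agRadius_pos_le m (by omega) hh hs hhs
  set A : ℝ := 2 * h ^ m / s with hA
  have hA0 : 0 < A := by positivity
  set c : ℝ := A ^ (1 / ((m : ℝ) - 1)) with hc_def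
  have hcs : c ≤ s / 2 := hch.trans hhs
  -- `hᵐ c^{2-m} = s c / 2`
  have hkey : h ^ m * c ^ (2 - (m : ℤ)) = s * c / 2 := by
    have h1 : c ^ (2 - (m : ℤ)) = c ^ 2 * (c ^ m)⁻¹ := by
      rw [show (2 - (m : ℤ)) = 2 + -(m : ℤ) by ring, zpow_add₀ hc0.ne', zpow_neg, zpow_natCast]
      norm_cast
    have h2 : c ^ m = c * A := by
      rw [← hcm1, ← pow_succ', Nat.sub_add_cancel (by omega : 1 ≤ m)]
    rw [h1, h2, hA]
    field_simp
  -- the three pieces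
  have hcoef : b / (2 * m) ≤ 2 * ((m : ℝ) - 1) / (m * s) := by
    rw [div_le_div_iff₀ (by positivity) (by positivity)]
    have := mul_le_mul_of_nonneg_right hb (by positivity : (0 : ℝ) ≤ m * s)
    calc b * (m * s) ≤ 4 * ((m : ℝ) - 1) / s * (m * s) := this
      _ = 2 * ((m : ℝ) - 1) * (2 * m) := by field_simp; ring
  have hbr_nonneg : 0 ≤ c ^ 2 + 2 / ((m : ℝ) - 2) * h ^ m * c ^ (2 - (m : ℤ)) := by
    rw [mul_assoc, hkey]; positivity
  have step1 : b / (2 * m) * (c ^ 2 + 2 / ((m : ℝ) - 2) * h ^ m * c ^ (2 - (m : ℤ)) -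
      m / ((m : ℝ) - 2) * h ^ 2) ≤
      2 * ((m : ℝ) - 1) / (m * s) * (c ^ 2 + 2 / ((m : ℝ) - 2) * h ^ m * c ^ (2 - (m : ℤ))) := by
    have h1 : b / (2 * m) * (c ^ 2 + 2 / ((m : ℝ) - 2) * h ^ m * c ^ (2 - (m : ℤ)) -
        m / ((m : ℝ) - 2) * h ^ 2) ≤
        b / (2 * m) * (c ^ 2 + 2 / ((m : ℝ) - 2) * h ^ m * c ^ (2 - (m : ℤ))) := by
      have : 0 ≤ b / (2 * m) * (m / ((m : ℝ) - 2) * h ^ 2) := by positivity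
      nlinarith
    exact h1.trans (mul_le_mul_of_nonneg_right hcoef hbr_nonneg)
  have step2 : 2 * ((m : ℝ) - 1) / (m * s) * (c ^ 2 + 2 / ((m : ℝ) - 2) * h ^ m * c ^ (2 - (m : ℤ)))
      ≤ ((m : ℝ) - 1) / m * c + 2 * ((m : ℝ) - 1) / (m * ((m : ℝ) - 2)) * c := by
    rw [mul_assoc (2 / ((m : ℝ) - 2)), hkey]
    have h1 : 2 * ((m : ℝ) - 1) / (m * s) * c ^ 2 ≤ ((m : ℝ) - 1) / m * c := by
      have h2 : 2 * ((m : ℝ) - 1) / (m * s) * c ^ 2 = ((m : ℝ) - 1) / m * c * (2 * c / s) := by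
        field_simp
      rw [h2]
      have h3 : 2 * c / s ≤ 1 := by rw [div_le_one hs]; linarith
      have h4 : 0 ≤ ((m : ℝ) - 1) / m * c := by positivity
      nlinarith
    have h2 : 2 * ((m : ℝ) - 1) / (m * s) * (2 / ((m : ℝ) - 2) * (s * c / 2)) =
        2 * ((m : ℝ) - 1) / (m * ((m : ℝ) - 2)) * c := by
      field_simp
    rw [mul_add, h2]
    linarith
  have step3 : ((m : ℝ) - 1) / m * c + 2 * ((m : ℝ) - 1) / (m * ((m : ℝ) - 2)) * c ≤ 2 * c := by
    have h1 : ((m : ℝ) - 1) / m + 2 * ((m : ℝ) - 1) / (m * ((m : ℝ) - 2)) = ((m : ℝ) - 1) / ((m : ℝ) - 2) := by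
      field_simp; ring
    have h2 : ((m : ℝ) - 1) / ((m : ℝ) - 2) ≤ 2 := by
      rw [div_le_iff₀ hm2]; linarith
    nlinarith
  -- `4 c ≤ 8 (hᵐ/s)^{1/(m-1)}`
  have step4 : c ≤ 2 * (h ^ m / s) ^ (1 / ((m : ℝ) - 1)) := by
    have h1 : A = 2 * (h ^ m / s) := by rw [hA]; ring
    rw [hc_def, h1, Real.mul_rpow (by norm_num) (by positivity)]
    have h2 : (2 : ℝ) ^ (1 / ((m : ℝ) - 1)) ≤ 2 := by
      conv_rhs => rw [← Real.rpow_one 2]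
      exact Real.rpow_le_rpow_of_exponent_le (by norm_num)
        ((div_le_one hm1).2 (by linarith))
    exact mul_le_mul_of_nonneg_right h2 (by positivity)
  linarith

/-! ### The excess estimate (Zhu 1997, Thm. 4.15) -/

section ExcessEstimate

variable {E : Type*} [NormedAddCommGroup E] [NormedSpace ℝ E] [FiniteDimensional ℝ E]
  [CompleteSpace E] {M : Type*} [TopologicalSpace M] [ChartedSpace E M] [IsManifold 𝓘(ℝ, E) ∞ M]
  [T2Space M]
  (g : PseudoRiemannianMetric 𝓘(ℝ, E) ∞ E (TangentSpace 𝓘(ℝ, E) : M → Type _)) [g.HasLeviCivita]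
  [CovariantDerivative.ContMDiffCovariantDerivative g.leviCivita 1]
  [CovariantDerivative.ContMDiffCovariantDerivative g.leviCivita ∞]

omit [CovariantDerivative.ContMDiffCovariantDerivative g.leviCivita ∞] in
/-- **The excess vanishes on a minimal segment** (Zhu 1997, Lemma 4.13 (3)): for a unit-speed
minimal geodesic `γ(t) = exp_p(t u)` on `[0, L]` and `q = γ(L)`,
`d(p, γ t) + d(γ t, q) - d(p, q) = 0` for `t ∈ [0, L]`. [cite: Zhu1997ComparisonRicci, Lemma 4.13] -/
theorem excess_expMap_smul_eq_zero (hg : g.IsRiemannian) (hc : IsGeodesicallyComplete g.leviCivita)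
    (p : M) (u : TangentSpace 𝓘(ℝ, E) p) (hu : g.val p u u = 1) {L : ℝ}
    (hmin : IsMinimizingUpTo g hg p u L) {t : ℝ} (ht0 : 0 ≤ t) (htL : t ≤ L) :
    (g.edist hg p (expMap g.leviCivita p (t • u))).toReal +
      (g.edist hg (expMap g.leviCivita p (L • u)) (expMap g.leviCivita p (t • u))).toReal -
        (g.edist hg p (expMap g.leviCivita p (L • u))).toReal = 0 := by
  have h0 : expMap g.leviCivita p ((0 : ℝ) • u) = p := by rw [zero_smul, expMap_zero]
  have h1 := edist_expMap_smul_expMap_smul g hg hc p u hu hmin le_rfl ht0 htL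
  have h2 := edist_expMap_smul_expMap_smul g hg hc p u hu hmin ht0 htL le_rfl
  have h3 := edist_expMap_smul_expMap_smul g hg hc p u hu hmin le_rfl (ht0.trans htL) le_rfl
  rw [h0] at h1 h3
  rw [h1, g.edist_comm hg, h2, h3, ENNReal.toReal_ofReal (by linarith),
    ENNReal.toReal_ofReal (by linarith), ENNReal.toReal_ofReal (by linarith)]
  ring

omit [CompleteSpace E] [g.HasLeviCivita]
  [CovariantDerivative.ContMDiffCovariantDerivative g.leviCivita 1]
  [CovariantDerivative.ContMDiffCovariantDerivative g.leviCivita ∞] in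
/-- **Foot points exist**: the distance from `x` to a continuous curve on a compact parameter
interval is attained. [folklore] -/
theorem exists_isMinOn_edist_curve (hg : g.IsRiemannian) {γ : ℝ → M} (hγ : Continuous γ) (x : M)
    {a b : ℝ} (hab : a ≤ b) :
    ∃ t₀ ∈ Icc a b, ∀ t ∈ Icc a b, g.edist hg x (γ t₀) ≤ g.edist hg x (γ t) := by
  haveI : LocallyCompactSpace M := Manifold.locallyCompact_of_finiteDimensional 𝓘(ℝ, E)
  haveI : RegularSpace M := inferInstance
  have hcont : ContinuousOn (fun t ↦ g.edist hg x (γ t)) (Icc a b) :=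
    ((PseudoRiemannianMetric.continuous_edist hg).comp (continuous_const.prodMk hγ)).continuousOn
  obtain ⟨t₀, ht₀, hmin⟩ := isCompact_Icc.exists_isMinOn (nonempty_Icc.2 hab) hcont
  exact ⟨t₀, ht₀, fun t ht ↦ hmin ht⟩

/-- **The Abresch–Gromoll excess estimate, `Ric ≥ 0`, raw form** (Zhu 1997, proof of
Thm. 4.15: Lemma 4.14 applied with `a = 2`, `b = 2(n-1)/(s - R)`, centre `x` and radius `R`):
on a connected Riemannian `m`-manifold (`m ≥ 3`) with complete Levi-Civita connection and
`Ric ≥ 0`, let `p, q, x, y₀ ∈ M` with zero excess at `y₀` (`d(p,y₀) + d(y₀,q) = d(p,q)`, e.g.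
`y₀` on a minimal segment from `p` to `q`), `d(x, y₀) < R < s := min(d(p,x), d(q,x))`. Then
for every `c ∈ (0, R)` and every `b' > 2(m-1)/(s-R)`,
`e(x) ≤ 2c + G_{b',R}(c)` with the Abresch–Gromoll profile `G`.
[cite: Zhu1997ComparisonRicci, Thm. 4.15 (proof)] [cite: AbreschGromoll1990, Prop. 2.3] -/
theorem excess_le_agProfile [ConnectedSpace M] (hg : g.IsRiemannian)
    (hc : IsGeodesicallyComplete g.leviCivita)
    (hRic : ∀ (x : M) (w : TangentSpace 𝓘(ℝ, E) x), 0 ≤ g.leviCivita.ricci x w w)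
    (hm : 3 ≤ Module.finrank ℝ E) {p q x y₀ : M}
    (hy₀ : (g.edist hg p y₀).toReal + (g.edist hg q y₀).toReal - (g.edist hg p q).toReal = 0)
    {R : ℝ} (hxy₀ : (g.edist hg x y₀).toReal < R)
    (hRp : R < (g.edist hg p x).toReal) (hRq : R < (g.edist hg q x).toReal)
    {c : ℝ} (hc0 : 0 < c) (hcR : c < R) {b' : ℝ}
    (hb' : ((Module.finrank ℝ E : ℝ) - 1) * (1 / ((g.edist hg p x).toReal - R) +
      1 / ((g.edist hg q x).toReal - R)) < b') :
    (g.edist hg p x).toReal + (g.edist hg q x).toReal - (g.edist hg p q).toReal ≤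
      2 * c + b' / (2 * (Module.finrank ℝ E : ℕ)) * (c ^ 2 + 2 / ((Module.finrank ℝ E : ℝ) - 2) *
        R ^ (Module.finrank ℝ E) * c ^ (2 - (Module.finrank ℝ E : ℤ)) -
          (Module.finrank ℝ E : ℕ) / ((Module.finrank ℝ E : ℝ) - 2) * R ^ 2) := by
  haveI : LocallyCompactSpace M := Manifold.locallyCompact_of_finiteDimensional 𝓘(ℝ, E)
  haveI : RegularSpace M := inferInstance
  set m := Module.finrank ℝ E with hm_def
  have hm0 : m ≠ 0 := by omega
  have hm1 : (1 : ℝ) ≤ (m : ℝ) - 1 := by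
    have : (3 : ℝ) ≤ m := by exact_mod_cast hm
    linarith
  have hR : 0 < R := hc0.trans hcR
  set dp := fun z : M ↦ (g.edist hg p z).toReal with hdp
  set dq := fun z : M ↦ (g.edist hg q z).toReal with hdq
  set e : M → ℝ := fun z ↦ dp z + dq z - (g.edist hg p q).toReal with he_def
  -- the barrier bound `b` on the ball `{d(x, ·) < R}`
  set b : ℝ := ((m : ℝ) - 1) * (1 / (dp x - R) + 1 / (dq x - R)) with hb_def
  have hb'pos : 0 < b' := by
    have h1 : 0 < 1 / (dp x - R) := by simp only [hdp]; exact one_div_pos.2 (by linarith)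
    have h2 : 0 < 1 / (dq x - R) := by simp only [hdq]; exact one_div_pos.2 (by linarith)
    have : 0 < b := by positivity
    linarith
  -- real triangle inequalities
  have htri : ∀ a' b' c' : M, (g.edist hg a' b').toReal ≤
      (g.edist hg a' c').toReal + (g.edist hg c' b').toReal := fun a' b' c' ↦ by
    have h := ENNReal.toReal_mono (ENNReal.add_ne_top.2 ⟨edist_ne_top hg a' c', edist_ne_top hg c' b'⟩)
      (g.edist_triangle hg a' c' b')
    rwa [ENNReal.toReal_add (edist_ne_top hg a' c') (edist_ne_top hg c' b')] at h
  have hsymm : ∀ a' b' : M, (g.edist hg a' b').toReal = (g.edist hg b' a').toReal := fun a' b' ↦ by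
    rw [g.edist_comm hg]
  -- apply the Abresch–Gromoll lemma with centre `x`, `u = e`, `a = 2`
  have key := abreschGromoll_lemma g hg hc hRic x hc0 hcR (b := (b + b') / 2) (b' := b')
    (G := fun r : ℝ ↦ b' / (2 * m) * (r ^ 2 + 2 / ((m : ℝ) - 2) * R ^ m * r ^ (2 - (m : ℤ)) -
      m / ((m : ℝ) - 2) * R ^ 2))
    (G' := fun r : ℝ ↦ b' / m * (r - R ^ m * r ^ (1 - (m : ℤ))))
    (G2 := fun r : ℝ ↦ b' / m * (1 + ((m : ℝ) - 1) * R ^ m * r ^ (-(m : ℤ))))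
    (fun r hr ↦ hasDerivAt_agProfile m hm b' R (by linarith [hr.1] : (0:ℝ) < r).ne')
    (fun r hr ↦ hasDerivAt_agProfile_deriv m b' R (by linarith [hr.1] : (0:ℝ) < r).ne')
    (strictAntiOn_agProfile m hm hb'pos hc0) (agProfile_apply_self m hm b' hR.ne') (by linarith)
    (fun r hr ↦ (agProfile_model m hm0 b' R (hc0.trans hr.1).ne').symm.le)
    (u := e) ?_ (a := 2) (by norm_num) ?_ ?_ (y₀ := y₀) ?_ ?_ ?_
  · simpa [he_def, hdp, hdq] using key
  · -- continuity of the excess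
    have hce : ∀ p' : M, Continuous fun z ↦ (g.edist hg p' z).toReal := fun p' ↦ by
      have h1 : Continuous fun z ↦ g.edist hg p' z :=
        (PseudoRiemannianMetric.continuous_edist hg).comp (continuous_const.prodMk continuous_id)
      exact continuous_iff_continuousAt.2 fun z ↦
        (ENNReal.tendsto_toReal (edist_ne_top hg p' z)).comp (h1.tendsto z)
    have hcp : Continuous dp := hce p
    have hcq : Continuous dq := hce q
    exact (hcp.add hcq).sub continuous_const
  · -- `2`-Lipschitz
    intro z z'
    exact abs_excess_sub_excess_le g hg p q z z'
  · intro z _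
    exact excess_nonneg g hg p q z
  · exact (ENNReal.lt_ofReal_iff_toReal_lt (edist_ne_top hg x y₀)).2 hxy₀
  · simpa [he_def, hdp, hdq] using hy₀
  · -- barriers on the ball: `z ≠ p, q` and `Δe ≤ b < (b + b')/2`
    intro z hz ε hε
    have hdz : (g.edist hg x z).toReal < R := ENNReal.toReal_lt_of_lt_ofReal hz
    have hpz : dp x - R < dp z := by
      have := htri p x z
      rw [hsymm z x] at this
      simp only [hdp]
      linarith
    have hqz : dq x - R < dq z := by
      have := htri q x z
      rw [hsymm z x] at this
      simp only [hdq]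
      linarith
    have hpz0 : 0 < dp z := by simp only [hdp] at hpz ⊢; linarith
    have hqz0 : 0 < dq z := by simp only [hdq] at hqz ⊢; linarith
    have hzp : z ≠ p := by
      intro h; rw [h] at hpz0; simp [hdp, PseudoRiemannianMetric.edist_self] at hpz0
    have hzq : z ≠ q := by
      intro h; rw [h] at hqz0; simp [hdq, PseudoRiemannianMetric.edist_self] at hqz0
    obtain ⟨φ, hφ, hmax, hΔ⟩ := upper_barriers_excess g hg hc hRic hzp hzq ε hε
    refine ⟨φ, hφ, by simpa [he_def, hdp, hdq] using hmax, hΔ.trans ?_⟩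
    have h1 : 1 / dp z ≤ 1 / (dp x - R) :=
      one_div_le_one_div_of_le (by simp only [hdp]; linarith) hpz.le
    have h2 : 1 / dq z ≤ 1 / (dq x - R) :=
      one_div_le_one_div_of_le (by simp only [hdq]; linarith) hqz.le
    have h3 : ((m : ℝ) - 1) * (1 / dp z + 1 / dq z) ≤ b :=
      mul_le_mul_of_nonneg_left (add_le_add h1 h2) (by linarith)
    have h4 : b < (b + b') / 2 := by linarith
    simp only [hdp, hdq] at h3 ⊢
    linarith

end ExcessEstimate
section ExcessEstimateFinal

variable {E : Type*} [NormedAddCommGroup E] [NormedSpace ℝ E] [FiniteDimensional ℝ E]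
  [CompleteSpace E] {M : Type*} [TopologicalSpace M] [ChartedSpace E M] [IsManifold 𝓘(ℝ, E) ∞ M]
  [T2Space M]
  (g : PseudoRiemannianMetric 𝓘(ℝ, E) ∞ E (TangentSpace 𝓘(ℝ, E) : M → Type _)) [g.HasLeviCivita]
  [CovariantDerivative.ContMDiffCovariantDerivative g.leviCivita 1]
  [CovariantDerivative.ContMDiffCovariantDerivative g.leviCivita ∞]

/-- **The Abresch–Gromoll excess estimate** (Abresch–Gromoll 1990, Prop. 2.3; Zhu 1997,
Thm. 4.15: "If `Ric ≥ 0` and `h(x) ≤ s(x)/2`, then `e(x) ≤ 8 (h(x)ⁿ/s)^{1/(n-1)}`"). On a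
connected Riemannian `m`-manifold, `m ≥ 3`, with complete Levi-Civita connection and `Ric ≥ 0`:
let `p, q, x ∈ M`, let `y₀` be a point of zero excess (`d(p, y₀) + d(y₀, q) = d(p, q)`; e.g. the
foot point of `x` on a minimal segment `γ` from `p` to `q`, `excess_expMap_smul_eq_zero`,
`exists_isMinOn_edist_curve`, so that `h = d(x, y₀)` is the height `dist(x, γ)`), and let
`0 < s ≤ min(d(p, x), d(q, x))` with `h = d(x, y₀) ≤ s/2`. Then
`e(x) = d(p, x) + d(x, q) - d(p, q) ≤ 8 (hᵐ/s)^{1/(m-1)}`.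
Proof: `excess_le_agProfile` with `R = h + η`, `c = (2hᵐ/s)^{1/(m-1)}`, `η → 0⁺`, and the
arithmetic `ag_arith`. [cite: AbreschGromoll1990, Prop. 2.3] [cite: Zhu1997ComparisonRicci, Thm. 4.15] -/
theorem abreschGromoll_excess_estimate [ConnectedSpace M] (hg : g.IsRiemannian)
    (hc : IsGeodesicallyComplete g.leviCivita)
    (hRic : ∀ (x : M) (w : TangentSpace 𝓘(ℝ, E) x), 0 ≤ g.leviCivita.ricci x w w)
    (hm : 3 ≤ Module.finrank ℝ E) {p q x y₀ : M}
    (hy₀ : (g.edist hg p y₀).toReal + (g.edist hg q y₀).toReal - (g.edist hg p q).toReal = 0)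
    {s : ℝ} (hs : 0 < s) (hsp : s ≤ (g.edist hg p x).toReal) (hsq : s ≤ (g.edist hg q x).toReal)
    (hh : (g.edist hg x y₀).toReal ≤ s / 2) :
    (g.edist hg p x).toReal + (g.edist hg q x).toReal - (g.edist hg p q).toReal ≤
      8 * ((g.edist hg x y₀).toReal ^ Module.finrank ℝ E / s) ^
        (1 / ((Module.finrank ℝ E : ℝ) - 1)) := by
  haveI : LocallyCompactSpace M := Manifold.locallyCompact_of_finiteDimensional 𝓘(ℝ, E)
  haveI : RegularSpace M := inferInstance
  set m := Module.finrank ℝ E with hm_def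
  have hm3 : (3 : ℝ) ≤ m := by exact_mod_cast hm
  set h : ℝ := (g.edist hg x y₀).toReal with hh_def
  set dpx := (g.edist hg p x).toReal with hdpx
  set dqx := (g.edist hg q x).toReal with hdqx
  -- the degenerate case `h = 0`: `x = y₀`
  rcases (ENNReal.toReal_nonneg : 0 ≤ h).eq_or_lt with h0 | hpos
  · have hxy : x = y₀ := by
      have h1 : g.edist hg x y₀ = 0 := by
        rcases (ENNReal.toReal_eq_zero_iff _).1 h0.symm with h2 | h2
        · exact h2
        · exact absurd h2 (edist_ne_top hg x y₀)
      exact (edist_eq_zero_iff hg).1 h1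
    subst hxy
    have h1 : dpx + dqx - (g.edist hg p q).toReal = 0 := by rw [hdpx, hdqx]; exact hy₀
    rw [h1]
    exact mul_nonneg (by norm_num)
      (Real.rpow_nonneg (div_nonneg (pow_nonneg ENNReal.toReal_nonneg _) hs.le) _)
  -- the radius `c`
  obtain ⟨hc0, -, hch⟩ := agRadius_pos_le m (by omega) hpos hs hh
  set c : ℝ := (2 * h ^ m / s) ^ (1 / ((m : ℝ) - 1)) with hc_def
  -- the bound for every small `η > 0`
  set F : ℝ → ℝ := fun η ↦ 2 * c + (((m : ℝ) - 1) * (1 / (dpx - (h + η)) + 1 / (dqx - (h + η))) + η) /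
    (2 * (m : ℕ)) * (c ^ 2 + 2 / ((m : ℝ) - 2) * (h + η) ^ m * c ^ (2 - (m : ℤ)) -
      (m : ℕ) / ((m : ℝ) - 2) * (h + η) ^ 2) with hF
  have hbound : ∀ η ∈ Ioo (0 : ℝ) (s / 2), dpx + dqx - (g.edist hg p q).toReal ≤ F η := by
    intro η hη
    have h1 := excess_le_agProfile g hg hc hRic hm hy₀ (R := h + η) (by linarith [hη.1])
      (by simp only [hdpx] at hsp; linarith [hη.2]) (by simp only [hdqx] at hsq; linarith [hη.2])
      hc0 (by linarith [hη.1]) (b' := ((m : ℝ) - 1) * (1 / (dpx - (h + η)) + 1 / (dqx - (h + η))) + η)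
      (by simp only [hdpx, hdqx]; linarith [hη.1])
    simpa [hF] using h1
  -- continuity of `F` at `0`
  have hden_p : dpx - (h + 0) ≠ 0 := by rw [add_zero]; linarith
  have hden_q : dqx - (h + 0) ≠ 0 := by rw [add_zero]; linarith
  have hFcont : ContinuousAt F 0 := by
    have hB : ContinuousAt (fun η : ℝ ↦ ((m : ℝ) - 1) * (1 / (dpx - (h + η)) + 1 / (dqx - (h + η))) + η) 0 := by
      refine ContinuousAt.add (ContinuousAt.mul continuousAt_const (ContinuousAt.add ?_ ?_))
        continuousAt_id
      · exact continuousAt_const.div (continuousAt_const.sub (continuousAt_const.add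
          continuousAt_id)) hden_p
      · exact continuousAt_const.div (continuousAt_const.sub (continuousAt_const.add
          continuousAt_id)) hden_q
    have hP : ContinuousAt (fun η : ℝ ↦ c ^ 2 + 2 / ((m : ℝ) - 2) * (h + η) ^ m * c ^ (2 - (m : ℤ)) -
        (m : ℕ) / ((m : ℝ) - 2) * (h + η) ^ 2) 0 := by
      have : Continuous (fun η : ℝ ↦ c ^ 2 + 2 / ((m : ℝ) - 2) * (h + η) ^ m * c ^ (2 - (m : ℤ)) -
          (m : ℕ) / ((m : ℝ) - 2) * (h + η) ^ 2) := by fun_prop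
      exact this.continuousAt
    simp only [hF]
    exact continuousAt_const.add ((hB.div_const _).mul hP)
  have hlim : Filter.Tendsto F (𝓝[>] 0) (𝓝 (F 0)) := hFcont.tendsto.mono_left nhdsWithin_le_nhds
  have hev : ∀ᶠ η in 𝓝[>] (0 : ℝ), dpx + dqx - (g.edist hg p q).toReal ≤ F η :=
    Filter.eventually_of_mem (Ioo_mem_nhdsGT (by positivity : (0 : ℝ) < s / 2)) hbound
  have hle : dpx + dqx - (g.edist hg p q).toReal ≤ F 0 := ge_of_tendsto hlim hev
  -- the arithmetic at `η = 0`
  have hB0 : ((m : ℝ) - 1) * (1 / (dpx - (h + 0)) + 1 / (dqx - (h + 0))) + 0 ≤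
      4 * ((m : ℝ) - 1) / s := by
    rw [add_zero, add_zero]
    have h1 : 1 / (dpx - h) ≤ 2 / s := by
      rw [show (2 : ℝ) / s = 1 / (s / 2) by field_simp]
      exact one_div_le_one_div_of_le (by positivity) (by linarith)
    have h2 : 1 / (dqx - h) ≤ 2 / s := by
      rw [show (2 : ℝ) / s = 1 / (s / 2) by field_simp]
      exact one_div_le_one_div_of_le (by positivity) (by linarith)
    have h3 : ((m : ℝ) - 1) * (1 / (dpx - h) + 1 / (dqx - h)) ≤ ((m : ℝ) - 1) * (2 / s + 2 / s) :=
      mul_le_mul_of_nonneg_left (add_le_add h1 h2) (by linarith)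
    calc _ ≤ ((m : ℝ) - 1) * (2 / s + 2 / s) := h3
      _ = 4 * ((m : ℝ) - 1) / s := by ring
  have hB0nn : 0 ≤ ((m : ℝ) - 1) * (1 / (dpx - (h + 0)) + 1 / (dqx - (h + 0))) + 0 := by
    rw [add_zero, add_zero]
    have h1 : 0 < dpx - h := by linarith
    have h2 : 0 < dqx - h := by linarith
    have : 0 ≤ (m : ℝ) - 1 := by linarith
    positivity
  have harith := ag_arith m hm hpos hs hh hB0nn hB0
  have hF0 : F 0 = 2 * (2 * h ^ m / s) ^ (1 / ((m : ℝ) - 1)) +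
      (((m : ℝ) - 1) * (1 / (dpx - (h + 0)) + 1 / (dqx - (h + 0))) + 0) / (2 * m) *
        (((2 * h ^ m / s) ^ (1 / ((m : ℝ) - 1))) ^ 2 +
          2 / ((m : ℝ) - 2) * h ^ m * ((2 * h ^ m / s) ^ (1 / ((m : ℝ) - 1))) ^ (2 - (m : ℤ)) -
            m / ((m : ℝ) - 2) * h ^ 2) := by
    simp only [hF, hc_def, add_zero]
  rw [hF0] at hle
  exact hle.trans harith

end ExcessEstimateFinal
end Literature.Geometry.Riemannian

end
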